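import Mathlib
import Literature.Analysis.FluidPDE.CheskidovFriedlander2009.SteadyState

/-!
# BC5 witness for `PointSink.ConeDesingularisation`: the cascade soliton of the
# two-sided unforced viscous dyadic model

Sibling-setting analogue of the deciding crux `ConeDesingularisation` (⟺ `CascadeSoliton`, landed
`Theorems.coneDesingularisation_iff_cascadeSoliton`) of `route-AnomalousDissipation-PointSink`,
DECIDED (true) in the bottom rung of the model hierarchy.

MODEL.  The Desnyansky–Novikov / Katz–Pavlović dyadic model in the Cheskidov–Friedlander normal
form of `Literature/Analysis/FluidPDE/CheskidovFriedlander2009/SteadyState.lean`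
(`u_{j−1}² − u_j u_{j+1} = μ r^j u_j`, `r = 2^{2(1−c/3)} > 1`, `μ` = reduced viscosity), but on the
TWO-SIDED lattice `j ∈ ℤ` and with NO forcing shell: energy can only enter "from `j = −∞`", i.e.
from ever larger scales, exactly as the point-sink soliton of the route is fed by its self-similar
far field and not by a body force.

DICTIONARY (route item ↔ here).  steady unforced unit-viscosity NS on ℝ³ ↔ `steady`;
`0 < ∫‖∇Q‖² < ∞` ↔ `0 < Σ_{j∈ℤ} μ r^j u_j² < ∞` (`summable`, `dissipation_pos`);
K41 envelope `∫_{B_R}‖Q‖² ≤ C R^{5/3}` + non-degenerate DSS far field `V(λx) = λ^{−2/3}V(x)` ↔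
in normal form the homogeneous profile is the CONSTANT sequence, and `farField` gives the two-sided
K41 bound `0 < m ≤ u_j ≤ M` on all large scales `j ≤ 1` while `selfSimilar` gives `u_{−k} → L > 0`
(asymptotically the EXACT homogeneous profile, `λ^{-5k/3}∫‖Q−V‖² → 0`); viscous core ↔ the
dissipation range `j → +∞` (`u_j → 0` super-exponentially, forced by `summable` with `r > 1`).
One-sided / finite-flux versions are TRIVIAL here (no input ⇒ zero flux ⇒ `u ≡ 0`), the analogue
of `Disproof.cascadeSoliton_infinite_energy`: the soliton must be fed from infinity.

WHY THIS IS A WITNESS (BC5 / tribunal T3).  The S-analogue in this model is the steady zeroth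
law of the FORCED one-sided model (`DyadicSteadyZerothLawAt r` below, shape of
`IsSteadyState.half_lt_tsum_dissipation` / `steadyState_zerothLaw`), which the tree proves ONLY
for `1 < r < 2` (`3/2 < c < 3`).  The present theorem holds for EVERY `r > 1`, in particular at
the Kolmogorov ratio `r = 2^{4/3}` (`c = 1`, the `k^{-5/3}` spectrum), where the S-analogue is not
a theorem in scope (`ConeDesingularisation_rung_K41`).  Not claimed: anything for `1 < r < 2`
beyond the same statement (there S' IS `steadyState_zerothLaw`), and nothing about Navier–Stokes —
the dyadic lattice carries no Liouville rigidity, so this rung certifies the consistency of the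
MECHANISM (an unforced, infinite-energy, self-similar-fed steady cascade with a viscous core and
`ν`-independent dissipation), not the NS analysis of the crux.

PROOF.  Forward shooting in `t = u₁` from `u₀ = x₀`: the orbit `u_{j+2} = u_j²/u_{j+1} − μr^{j+1}`
dies (first `u_n ≤ 0`) at `n = 1` for `t ≤ 0` and at `n = 2` for `t ≥ x₀²/(μr)`; the PARITY of the
death index is locally constant in `t` (a death through an exact zero is followed by a death two
shells later), so if every orbit died, `ℝ` would split into two disjoint non-empty open sets.  Hence
an immortal positive forward orbit exists; backwards the recursion `u_{j−1} = √(u_j(u_{j+1}+μr^j))`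
is always solvable, positive, bounded below by `min(u₀,u₁)` and above by `max(u₀,u₁) + μr/(r−1)`;
the flux `P_j = u_j²u_{j+1}` telescopes the dissipation (`P_{j−1} − P_j = μr^j u_j²`), which is
therefore summable over `ℤ`; in logarithmic variables the backward increments obey
`D_{k+1} = −D_k/2 + δ_k/2`, `0 ≤ δ_k ≤ μr^{−k}/m`, so they are summable and `u_{−k} → L > 0`.
-/

noncomputable section

open Filter Topology Finset

namespace Summit.AnomalousDissipation.AnomalousDissipation.Cruxes.ConeDesingularisation.DyadicRung

/-! ## The forward shooting orbit -/

/-- The forward orbit of the steady recursion `u_{j+2} = u_j²/u_{j+1} − μ r^{j+1}` from `u₀ = x₀`,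
`u₁ = t` (continued formally through non-positive values; `x/0 = 0`). -/
def orb (μ r x₀ t : ℝ) : ℕ → ℝ
  | 0 => x₀
  | 1 => t
  | j + 2 => orb μ r x₀ t j ^ 2 / orb μ r x₀ t (j + 1) - μ * r ^ (j + 1)

variable {μ r x₀ : ℝ}

@[simp] theorem orb_zero (t : ℝ) : orb μ r x₀ t 0 = x₀ := rfl

@[simp] theorem orb_one (t : ℝ) : orb μ r x₀ t 1 = t := rfl

theorem orb_add_two (t : ℝ) (j : ℕ) :
    orb μ r x₀ t (j + 2) = orb μ r x₀ t j ^ 2 / orb μ r x₀ t (j + 1) - μ * r ^ (j + 1) := rfl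

/-- The steady equation along the forward orbit wherever the divisor is non-zero. -/
theorem orb_rel (t : ℝ) (j : ℕ) (h : orb μ r x₀ t (j + 1) ≠ 0) :
    orb μ r x₀ t j ^ 2 - orb μ r x₀ t (j + 1) * orb μ r x₀ t (j + 2) =
      μ * r ^ (j + 1) * orb μ r x₀ t (j + 1) := by
  rw [orb_add_two]
  field_simp
  ring

/-- `t ↦ orb t j` is continuous at `t₀` for `j ≤ m + 1` as soon as `orb t₀ i ≠ 0` for `i ≤ m`. -/
theorem continuousAt_orb (t₀ : ℝ) (m : ℕ) (h : ∀ i, i ≤ m → orb μ r x₀ t₀ i ≠ 0) :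
    ∀ j, j ≤ m + 1 → ContinuousAt (fun t => orb μ r x₀ t j) t₀ := by
  have key : ∀ j, j ≤ m → ContinuousAt (fun t => orb μ r x₀ t j) t₀ ∧
      ContinuousAt (fun t => orb μ r x₀ t (j + 1)) t₀ := by
    intro j
    induction j with
    | zero => intro; exact ⟨continuousAt_const, continuousAt_id⟩
    | succ j ih =>
      intro hj
      have ih' := ih (by omega)
      refine ⟨ih'.2, ?_⟩
      have hne : orb μ r x₀ t₀ (j + 1) ≠ 0 := h (j + 1) hj
      have hc : ContinuousAt
          (fun t => orb μ r x₀ t j ^ 2 / orb μ r x₀ t (j + 1) - μ * r ^ (j + 1)) t₀ :=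
        ((ih'.1.pow 2).div ih'.2 hne).sub continuousAt_const
      simpa only [orb_add_two] using hc
  intro j hj
  cases j with
  | zero => exact continuousAt_const
  | succ i => exact (key i (by omega)).2

/-- "The orbit from `t` dies exactly at shell `n`": positive before `n`, non-positive at `n`. -/
def DiesAt (μ r x₀ t : ℝ) (n : ℕ) : Prop :=
  (∀ j, j < n → 0 < orb μ r x₀ t j) ∧ orb μ r x₀ t n ≤ 0

theorem DiesAt.unique {t : ℝ} {n n' : ℕ} (h : DiesAt μ r x₀ t n) (h' : DiesAt μ r x₀ t n') :
    n = n' := by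
  by_contra hne
  rcases Nat.lt_or_gt_of_ne hne with hlt | hgt
  · exact absurd h.2 (not_le.mpr (h'.1 n hlt))
  · exact absurd h'.2 (not_le.mpr (h.1 n' hgt))

/-- **Parity step.**  Near an orbit dying at shell `m + 1`, every orbit dies at shell `m + 1` or at
shell `m + 3`: a death through an exact zero `u_{m+1} = 0⁺` makes `u_{m+2}` huge and `u_{m+3} < 0`. -/
theorem DiesAt.eventually (hμ : 0 < μ) (hr : 0 < r) {t₀ : ℝ} {m : ℕ}
    (h : DiesAt μ r x₀ t₀ (m + 1)) :
    ∀ᶠ t in 𝓝 t₀, DiesAt μ r x₀ t (m + 1) ∨ DiesAt μ r x₀ t (m + 3) := by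
  have hpos : ∀ j, j ≤ m → 0 < orb μ r x₀ t₀ j := fun j hj => h.1 j (by omega)
  have hcont := continuousAt_orb t₀ m fun i hi => (hpos i hi).ne'
  -- (E0) the positive prefix persists
  have E0 : ∀ᶠ t in 𝓝 t₀, ∀ j ∈ range (m + 1), 0 < orb μ r x₀ t j := by
    refine (eventually_all_finset _).mpr fun j hj => ?_
    have hj' : j ≤ m := by simpa [mem_range, Nat.lt_succ_iff] using hj
    exact (hcont j (by omega)).eventually (lt_mem_nhds (hpos j hj'))
  -- (E1) `(1 + μ r^{m+1}) u_{m+1} < u_m²` persists (at `t₀` the left side is `≤ 0 < u_m²`)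
  have E1 : ∀ᶠ t in 𝓝 t₀, (1 + μ * r ^ (m + 1)) * orb μ r x₀ t (m + 1) < orb μ r x₀ t m ^ 2 := by
    have hg : ContinuousAt
        (fun t => orb μ r x₀ t m ^ 2 - (1 + μ * r ^ (m + 1)) * orb μ r x₀ t (m + 1)) t₀ :=
      ((hcont m (by omega)).pow 2).sub (continuousAt_const.mul (hcont (m + 1) le_rfl))
    have hg0 : 0 < orb μ r x₀ t₀ m ^ 2 - (1 + μ * r ^ (m + 1)) * orb μ r x₀ t₀ (m + 1) := by
      have h1 : 0 < orb μ r x₀ t₀ m ^ 2 := pow_pos (hpos m le_rfl) 2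
      have h2 : (1 + μ * r ^ (m + 1)) * orb μ r x₀ t₀ (m + 1) ≤ 0 :=
        mul_nonpos_of_nonneg_of_nonpos (by positivity) h.2
      linarith
    filter_upwards [hg.eventually (lt_mem_nhds hg0)] with t ht
    linarith
  -- conclusion from (E0), (E1) and either `u_{m+1} < 0` persisting or `u_{m+1}² < μ r^{m+2}`
  have finish : ∀ t, (∀ j ∈ range (m + 1), 0 < orb μ r x₀ t j) →
      (1 + μ * r ^ (m + 1)) * orb μ r x₀ t (m + 1) < orb μ r x₀ t m ^ 2 →
      (orb μ r x₀ t (m + 1) ≤ 0 ∨ orb μ r x₀ t (m + 1) ^ 2 < μ * r ^ (m + 2)) →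
      DiesAt μ r x₀ t (m + 1) ∨ DiesAt μ r x₀ t (m + 3) := by
    intro t h0 h1 h2
    have h0' : ∀ j, j < m + 1 → 0 < orb μ r x₀ t j := fun j hj => h0 j (mem_range.mpr hj)
    by_cases hs : orb μ r x₀ t (m + 1) ≤ 0
    · exact Or.inl ⟨h0', hs⟩
    · right
      push Not at hs
      have h2' : orb μ r x₀ t (m + 1) ^ 2 < μ * r ^ (m + 2) := h2.resolve_left (not_le.mpr hs)
      have hbig : 1 < orb μ r x₀ t (m + 2) := by
        rw [orb_add_two]
        have : 1 + μ * r ^ (m + 1) < orb μ r x₀ t m ^ 2 / orb μ r x₀ t (m + 1) :=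
          (lt_div_iff₀ hs).mpr h1
        linarith
      have hlast : orb μ r x₀ t (m + 3) < 0 := by
        rw [show m + 3 = (m + 1) + 2 from rfl, orb_add_two]
        have : orb μ r x₀ t (m + 1) ^ 2 / orb μ r x₀ t (m + 1 + 1) ≤ orb μ r x₀ t (m + 1) ^ 2 :=
          div_le_self (sq_nonneg _) hbig.le
        have hr' : μ * r ^ (m + 1 + 1) = μ * r ^ (m + 2) := rfl
        linarith
      refine ⟨fun j hj => ?_, hlast.le⟩
      rcases (by omega : j < m + 1 ∨ j = m + 1 ∨ j = m + 2) with hj' | rfl | rfl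
      · exact h0' j hj'
      · exact hs
      · linarith
  rcases h.2.lt_or_eq with hlt | heq
  · have E3 : ∀ᶠ t in 𝓝 t₀, orb μ r x₀ t (m + 1) < 0 :=
      (hcont (m + 1) le_rfl).eventually (gt_mem_nhds hlt)
    filter_upwards [E0, E1, E3] with t h0 h1 h3
    exact finish t h0 h1 (Or.inl h3.le)
  · have E2 : ∀ᶠ t in 𝓝 t₀, orb μ r x₀ t (m + 1) ^ 2 < μ * r ^ (m + 2) := by
      have hsq0 : orb μ r x₀ t₀ (m + 1) ^ 2 < μ * r ^ (m + 2) := by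
        rw [heq]; simpa using by positivity
      exact ((hcont (m + 1) le_rfl).pow 2).eventually (gt_mem_nhds hsq0)
    filter_upwards [E0, E1, E2] with t h0 h1 h2
    exact finish t h0 h1 (Or.inr h2)

/-- **Shooting.**  For `μ, r, x₀ > 0` some `u₁ = t` gives a forward orbit that stays positive for
ever (connectedness of `ℝ` + the parity step). -/
theorem exists_immortal (hμ : 0 < μ) (hr : 0 < r) (hx : 0 < x₀) :
    ∃ t : ℝ, ∀ j, 0 < orb μ r x₀ t j := by
  classical
  by_contra hall
  push Not at hall
  -- every orbit dies at a (unique) first shell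
  have hdies : ∀ t, ∃ n, DiesAt μ r x₀ t n := by
    intro t
    have H : ∃ n, orb μ r x₀ t n ≤ 0 := hall t
    exact ⟨Nat.find H, fun i hi => lt_of_not_ge (Nat.find_min H hi), Nat.find_spec H⟩
  have hn0 : ∀ t n, DiesAt μ r x₀ t n → n ≠ 0 := by
    rintro t n hd rfl
    exact absurd hd.2 (not_le.mpr (by simpa using hx))
  set U : Set ℝ := {t | ∃ n, Odd n ∧ DiesAt μ r x₀ t n} with hU
  set V : Set ℝ := {t | ∃ n, Even n ∧ DiesAt μ r x₀ t n} with hV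
  have hUo : IsOpen U := by
    refine isOpen_iff_eventually.mpr fun t₀ ⟨n, hn, hd⟩ => ?_
    obtain ⟨m, rfl⟩ : ∃ m, n = m + 1 := Nat.exists_eq_add_one_of_ne_zero (hn0 t₀ n hd)
    filter_upwards [hd.eventually hμ hr] with t ht
    rcases ht with ht | ht
    · exact ⟨m + 1, hn, ht⟩
    · exact ⟨m + 3, by simpa [Nat.odd_add_one, Nat.even_add_one] using hn, ht⟩
  have hVo : IsOpen V := by
    refine isOpen_iff_eventually.mpr fun t₀ ⟨n, hn, hd⟩ => ?_
    obtain ⟨m, rfl⟩ : ∃ m, n = m + 1 := Nat.exists_eq_add_one_of_ne_zero (hn0 t₀ n hd)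
    filter_upwards [hd.eventually hμ hr] with t ht
    rcases ht with ht | ht
    · exact ⟨m + 1, hn, ht⟩
    · exact ⟨m + 3, by simpa [Nat.odd_add_one, Nat.even_add_one] using hn, ht⟩
  have hcover : Set.univ ⊆ U ∪ V := by
    intro t _
    obtain ⟨n, hd⟩ := hdies t
    rcases Nat.even_or_odd n with he | ho
    · exact Or.inr ⟨n, he, hd⟩
    · exact Or.inl ⟨n, ho, hd⟩
  -- `t = -1` dies at shell 1, `t = x₀²/(μr) + 1` dies at shell 2
  have hU1 : (Set.univ ∩ U).Nonempty := by
    refine ⟨-1, trivial, 1, odd_one, fun j hj => ?_, by simp⟩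
    have : j = 0 := by omega
    subst this; simpa using hx
  have hV1 : (Set.univ ∩ V).Nonempty := by
    set T : ℝ := x₀ ^ 2 / (μ * r) + 1 with hT
    have hT0 : 0 < T := by positivity
    refine ⟨T, trivial, 2, even_two, fun j hj => ?_, ?_⟩
    · rcases (by omega : j = 0 ∨ j = 1) with rfl | rfl
      · simpa using hx
      · simpa using hT0
    · change orb μ r x₀ T 0 ^ 2 / orb μ r x₀ T 1 - μ * r ^ (0 + 1) ≤ 0
      simp only [orb_zero, orb_one, zero_add, pow_one]
      have h1 : x₀ ^ 2 / T ≤ μ * r := by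
        rw [div_le_iff₀ hT0, hT]
        have : μ * r * (x₀ ^ 2 / (μ * r)) = x₀ ^ 2 := by field_simp
        nlinarith [mul_pos hμ hr]
      linarith
  have hconn : IsPreconnected (Set.univ : Set ℝ) := isPreconnected_univ
  obtain ⟨t, -, ⟨n, hn, hd⟩, ⟨n', hn', hd'⟩⟩ := hconn U V hUo hVo hcover hU1 hV1
  have := hd.unique hd'
  subst this
  exact (Nat.not_even_iff_odd.mpr hn) hn'

/-- Along an immortal forward orbit the flux `P_j = u_j² u_{j+1}` telescopes the dissipation. -/
theorem sum_range_dissipation_eq {t : ℝ} (ht : ∀ j, 0 < orb μ r x₀ t j) (N : ℕ) :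
    ∑ i ∈ range N, μ * r ^ (i + 1) * orb μ r x₀ t (i + 1) ^ 2 =
      orb μ r x₀ t 0 ^ 2 * orb μ r x₀ t 1 - orb μ r x₀ t N ^ 2 * orb μ r x₀ t (N + 1) := by
  have hterm : ∀ i, μ * r ^ (i + 1) * orb μ r x₀ t (i + 1) ^ 2 =
      orb μ r x₀ t i ^ 2 * orb μ r x₀ t (i + 1) -
        orb μ r x₀ t (i + 1) ^ 2 * orb μ r x₀ t (i + 1 + 1) := by
    intro i
    have h := orb_rel t i (ht (i + 1)).ne'
    have e : orb μ r x₀ t (i + 1 + 1) = orb μ r x₀ t (i + 2) := rfl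
    have h' : μ * r ^ (i + 1) * orb μ r x₀ t (i + 1) ^ 2 =
        (orb μ r x₀ t i ^ 2 - orb μ r x₀ t (i + 1) * orb μ r x₀ t (i + 2)) *
          orb μ r x₀ t (i + 1) := by
      rw [h]; ring
    rw [h', e]; ring
  simp_rw [hterm]
  exact sum_range_sub' (fun i => orb μ r x₀ t i ^ 2 * orb μ r x₀ t (i + 1)) N

theorem summable_dissipation_forward (hμ : 0 < μ) (hr : 0 < r) {t : ℝ}
    (ht : ∀ j, 0 < orb μ r x₀ t j) :
    Summable fun n : ℕ => μ * r ^ n * orb μ r x₀ t n ^ 2 := by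
  have hs : Summable fun i : ℕ => μ * r ^ (i + 1) * orb μ r x₀ t (i + 1) ^ 2 := by
    refine summable_of_sum_range_le (c := orb μ r x₀ t 0 ^ 2 * orb μ r x₀ t 1)
      (fun i => by positivity) fun N => ?_
    rw [sum_range_dissipation_eq ht N]
    have : 0 ≤ orb μ r x₀ t N ^ 2 * orb μ r x₀ t (N + 1) := by
      have := ht (N + 1); positivity
    linarith
  exact (summable_nat_add_iff 1).mp hs

/-! ## The backward orbit -/

/-- The backward orbit: `back 0 = u₁`, `back 1 = u₀` and
`back (k+2) = √(back (k+1) · (back k + μ r^{-k}))`, so that `v_{1−k} := back k` solves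
`v_{j−1}² = v_j (v_{j+1} + μ r^j)` for all `j ≤ 0`. -/
def back (μ r u₀ u₁ : ℝ) : ℕ → ℝ
  | 0 => u₁
  | 1 => u₀
  | k + 2 => Real.sqrt (back μ r u₀ u₁ (k + 1) * (back μ r u₀ u₁ k + μ * r⁻¹ ^ k))

variable {u₀ u₁ : ℝ}

@[simp] theorem back_zero : back μ r u₀ u₁ 0 = u₁ := rfl

@[simp] theorem back_one : back μ r u₀ u₁ 1 = u₀ := rfl

theorem back_add_two (k : ℕ) : back μ r u₀ u₁ (k + 2) =
    Real.sqrt (back μ r u₀ u₁ (k + 1) * (back μ r u₀ u₁ k + μ * r⁻¹ ^ k)) := rfl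

/-- Positivity and the lower K41 bound `min u₀ u₁ ≤ back k`. -/
theorem min_le_back (hμ : 0 ≤ μ) (hr : 0 < r) (h0 : 0 < u₀) (h1 : 0 < u₁) :
    ∀ k, min u₀ u₁ ≤ back μ r u₀ u₁ k := by
  have hm : 0 < min u₀ u₁ := lt_min h0 h1
  have key : ∀ k, min u₀ u₁ ≤ back μ r u₀ u₁ k ∧ min u₀ u₁ ≤ back μ r u₀ u₁ (k + 1) := by
    intro k
    induction k with
    | zero => exact ⟨min_le_right _ _, min_le_left _ _⟩
    | succ k ih =>
      refine ⟨ih.2, ?_⟩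
      rw [show k + 1 + 1 = k + 2 from rfl, back_add_two]
      have hc : 0 ≤ μ * r⁻¹ ^ k := by positivity
      have ha : min u₀ u₁ ≤ back μ r u₀ u₁ (k + 1) := ih.2
      have hb : min u₀ u₁ ≤ back μ r u₀ u₁ k + μ * r⁻¹ ^ k := by linarith [ih.1]
      have hprod : min u₀ u₁ ^ 2 ≤ back μ r u₀ u₁ (k + 1) * (back μ r u₀ u₁ k + μ * r⁻¹ ^ k) := by
        rw [sq]
        exact mul_le_mul ha hb hm.le (by linarith)
      calc min u₀ u₁ = Real.sqrt (min u₀ u₁ ^ 2) := (Real.sqrt_sq hm.le).symm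
        _ ≤ _ := Real.sqrt_le_sqrt hprod
  exact fun k => (key k).1

theorem back_pos (hμ : 0 ≤ μ) (hr : 0 < r) (h0 : 0 < u₀) (h1 : 0 < u₁) (k : ℕ) :
    0 < back μ r u₀ u₁ k :=
  lt_of_lt_of_le (lt_min h0 h1) (min_le_back hμ hr h0 h1 k)

theorem back_add_two_sq (hμ : 0 ≤ μ) (hr : 0 < r) (h0 : 0 < u₀) (h1 : 0 < u₁) (k : ℕ) :
    back μ r u₀ u₁ (k + 2) ^ 2 = back μ r u₀ u₁ (k + 1) * (back μ r u₀ u₁ k + μ * r⁻¹ ^ k) := by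
  rw [back_add_two]
  refine Real.sq_sqrt ?_
  have := back_pos hμ hr h0 h1 (k + 1)
  have := back_pos hμ hr h0 h1 k
  positivity

/-- The upper K41 bound: `back k ≤ max u₀ u₁ + μ Σ_{i<k} r^{-i}`. -/
theorem back_le (hμ : 0 ≤ μ) (hr : 0 < r) (h0 : 0 < u₀) (h1 : 0 < u₁) :
    ∀ k, back μ r u₀ u₁ k ≤ max u₀ u₁ + μ * ∑ i ∈ range k, r⁻¹ ^ i := by
  set B : ℕ → ℝ := fun k => max u₀ u₁ + μ * ∑ i ∈ range k, r⁻¹ ^ i with hB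
  have hBmono : ∀ k, B k ≤ B (k + 1) := fun k => by
    simp only [hB, sum_range_succ]
    nlinarith [pow_nonneg (inv_nonneg.mpr hr.le) k]
  have hBsucc : ∀ k, B (k + 1) = B k + μ * r⁻¹ ^ k := fun k => by
    simp only [hB, sum_range_succ]; ring
  have key : ∀ k, back μ r u₀ u₁ k ≤ B k ∧ back μ r u₀ u₁ (k + 1) ≤ B k := by
    intro k
    induction k with
    | zero => exact ⟨by simp [hB], by simp [hB]⟩
    | succ k ih =>
      refine ⟨ih.2.trans (hBmono k), ?_⟩
      rw [show k + 1 + 1 = k + 2 from rfl, back_add_two, hBsucc]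
      have hc : 0 ≤ μ * r⁻¹ ^ k := by positivity
      have hBk : 0 ≤ B k := (back_pos hμ hr h0 h1 k).le.trans ih.1
      have hprod : back μ r u₀ u₁ (k + 1) * (back μ r u₀ u₁ k + μ * r⁻¹ ^ k) ≤
          (B k + μ * r⁻¹ ^ k) ^ 2 := by
        rw [sq]
        exact mul_le_mul (by linarith [ih.2]) (by linarith [ih.1])
          (by linarith [(back_pos hμ hr h0 h1 k).le]) (by linarith)
      calc Real.sqrt _ ≤ Real.sqrt ((B k + μ * r⁻¹ ^ k) ^ 2) := Real.sqrt_le_sqrt hprod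
        _ = B k + μ * r⁻¹ ^ k := Real.sqrt_sq (by linarith)
  exact fun k => (key k).1

/-- A uniform bound on the large scales when `r > 1`: `back k ≤ max u₀ u₁ + μ r/(r−1)`. -/
theorem back_le_const (hμ : 0 ≤ μ) (hr : 1 < r) (h0 : 0 < u₀) (h1 : 0 < u₁) (k : ℕ) :
    back μ r u₀ u₁ k ≤ max u₀ u₁ + μ * (1 - r⁻¹)⁻¹ := by
  have hr0 : 0 < r := by linarith
  have hq0 : 0 ≤ r⁻¹ := inv_nonneg.mpr hr0.le
  have hq1 : r⁻¹ < 1 := inv_lt_one_of_one_lt₀ hr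
  have hgeom : ∑ i ∈ range k, r⁻¹ ^ i ≤ (1 - r⁻¹)⁻¹ := by
    rw [← tsum_geometric_of_lt_one hq0 hq1]
    exact (summable_geometric_of_lt_one hq0 hq1).sum_le_tsum (range k) fun i _ => pow_nonneg hq0 i
  have := back_le hμ hr0 h0 h1 k
  nlinarith

/-- The backward flux telescoping: `Σ_{k<K} μ r^{-k} (back (k+1))² = P'_K − P'_0` with
`P'_k = (back (k+1))² · back k`. -/
theorem sum_range_dissipation_back_eq (hμ : 0 ≤ μ) (hr : 0 < r) (h0 : 0 < u₀) (h1 : 0 < u₁)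
    (K : ℕ) :
    ∑ k ∈ range K, μ * r⁻¹ ^ k * back μ r u₀ u₁ (k + 1) ^ 2 =
      back μ r u₀ u₁ (K + 1) ^ 2 * back μ r u₀ u₁ K - back μ r u₀ u₁ 1 ^ 2 * back μ r u₀ u₁ 0 := by
  have hterm : ∀ k, μ * r⁻¹ ^ k * back μ r u₀ u₁ (k + 1) ^ 2 =
      back μ r u₀ u₁ (k + 1 + 1) ^ 2 * back μ r u₀ u₁ (k + 1) -
        back μ r u₀ u₁ (k + 1) ^ 2 * back μ r u₀ u₁ k := by
    intro k
    have h := back_add_two_sq hμ hr h0 h1 k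
    rw [show k + 1 + 1 = k + 2 from rfl, h]
    ring
  simp_rw [hterm]
  exact sum_range_sub (fun k => back μ r u₀ u₁ (k + 1) ^ 2 * back μ r u₀ u₁ k) K

theorem summable_dissipation_back (hμ : 0 ≤ μ) (hr : 1 < r) (h0 : 0 < u₀) (h1 : 0 < u₁) :
    Summable fun k : ℕ => μ * r⁻¹ ^ k * back μ r u₀ u₁ (k + 1) ^ 2 := by
  have hr0 : 0 < r := by linarith
  set Bc : ℝ := max u₀ u₁ + μ * (1 - r⁻¹)⁻¹ with hBc
  have hb : ∀ k, back μ r u₀ u₁ k ≤ Bc := back_le_const hμ hr h0 h1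
  have hBc0 : 0 ≤ Bc := (back_pos hμ hr0 h0 h1 0).le.trans (hb 0)
  refine summable_of_sum_range_le (c := Bc ^ 2 * Bc) (fun k => by positivity) fun K => ?_
  rw [sum_range_dissipation_back_eq hμ hr0 h0 h1 K]
  have h2 : back μ r u₀ u₁ (K + 1) ^ 2 * back μ r u₀ u₁ K ≤ Bc ^ 2 * Bc := by
    have hK := hb K
    have hK1 := hb (K + 1)
    have := back_pos hμ hr0 h0 h1 K
    have := back_pos hμ hr0 h0 h1 (K + 1)
    have hsq : back μ r u₀ u₁ (K + 1) ^ 2 ≤ Bc ^ 2 := by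
      exact pow_le_pow_left₀ (by linarith) hK1 2
    exact mul_le_mul hsq hK (by linarith) (by positivity)
  have h3 : 0 ≤ back μ r u₀ u₁ 1 ^ 2 * back μ r u₀ u₁ 0 := by
    have := back_pos hμ hr0 h0 h1 0; positivity
  linarith

/-- **Self-similar far field.**  The backward orbit converges, `back k → L > 0` (`r > 1`): in the
original variables `a_j · 2^{cj/3} → const` as `j → −∞`, i.e. on the large scales the soliton is
asymptotically the EXACT Kolmogorov (fixed-point) profile — the dyadic form of the crux's discretely
self-similar far field `λ^{-5k/3}∫_{shell k}‖Q − V‖² → 0`.  Proof: in logarithmic variables the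
increments satisfy `D_{k+1} = −D_k/2 + δ_k/2` with `0 ≤ δ_k ≤ μ r^{-k}/m`, hence are summable. -/
theorem tendsto_back (hμ : 0 ≤ μ) (hr : 1 < r) (h0 : 0 < u₀) (h1 : 0 < u₁) :
    ∃ L : ℝ, 0 < L ∧ Tendsto (back μ r u₀ u₁) atTop (𝓝 L) := by
  have hr0 : 0 < r := by linarith
  have hq0 : 0 ≤ r⁻¹ := inv_nonneg.mpr hr0.le
  have hq1 : r⁻¹ < 1 := inv_lt_one_of_one_lt₀ hr
  set b := back μ r u₀ u₁ with hb
  have hbpos : ∀ k, 0 < b k := back_pos hμ hr0 h0 h1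
  have hm0 : 0 < min u₀ u₁ := lt_min h0 h1
  have hmb : ∀ k, min u₀ u₁ ≤ b k := min_le_back hμ hr0 h0 h1
  have hc0 : ∀ k : ℕ, 0 ≤ μ * r⁻¹ ^ k := fun k => by positivity
  -- logarithmic increments
  set D : ℕ → ℝ := fun k => Real.log (b (k + 1)) - Real.log (b k) with hD
  have hrec : ∀ k, D (k + 1) =
      -(D k) / 2 + (Real.log (b k + μ * r⁻¹ ^ k) - Real.log (b k)) / 2 := by
    intro k
    have hsq : b (k + 2) ^ 2 = b (k + 1) * (b k + μ * r⁻¹ ^ k) := back_add_two_sq hμ hr0 h0 h1 k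
    have hne : b k + μ * r⁻¹ ^ k ≠ 0 := by linarith [hbpos k, hc0 k]
    have e1 : Real.log (b (k + 2) ^ 2) = 2 * Real.log (b (k + 2)) := by
      rw [Real.log_pow]; norm_num
    have e2 : Real.log (b (k + 2) ^ 2) = Real.log (b (k + 1)) + Real.log (b k + μ * r⁻¹ ^ k) := by
      rw [hsq, Real.log_mul (hbpos _).ne' hne]
    have e3 : b (k + 1 + 1) = b (k + 2) := rfl
    simp only [hD, e3]
    linarith
  have hδ0 : ∀ k, 0 ≤ Real.log (b k + μ * r⁻¹ ^ k) - Real.log (b k) := fun k => by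
    linarith [Real.log_le_log (hbpos k) (by linarith [hc0 k] : b k ≤ b k + μ * r⁻¹ ^ k)]
  have hδ1 : ∀ k, Real.log (b k + μ * r⁻¹ ^ k) - Real.log (b k) ≤ μ * r⁻¹ ^ k / min u₀ u₁ := by
    intro k
    have hbk := hbpos k
    rw [← Real.log_div (by linarith [hc0 k]) hbk.ne']
    have h1 : Real.log ((b k + μ * r⁻¹ ^ k) / b k) ≤ (b k + μ * r⁻¹ ^ k) / b k - 1 :=
      Real.log_le_sub_one_of_pos (by have := hc0 k; positivity)
    have h2 : (b k + μ * r⁻¹ ^ k) / b k - 1 = μ * r⁻¹ ^ k / b k := by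
      field_simp
      ring
    have h3 : μ * r⁻¹ ^ k / b k ≤ μ * r⁻¹ ^ k / min u₀ u₁ :=
      div_le_div_of_nonneg_left (hc0 k) hm0 (hmb k)
    linarith
  have habs : ∀ k, |D (k + 1)| ≤ |D k| / 2 + (μ * r⁻¹ ^ k / min u₀ u₁) / 2 := by
    intro k
    rw [hrec k]
    have e1 : |-(D k) / 2| = |D k| / 2 := by rw [abs_div, abs_neg, abs_two]
    have e2 : |(Real.log (b k + μ * r⁻¹ ^ k) - Real.log (b k)) / 2| =
        (Real.log (b k + μ * r⁻¹ ^ k) - Real.log (b k)) / 2 := abs_of_nonneg (by linarith [hδ0 k])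
    calc _ ≤ |-(D k) / 2| + |(Real.log (b k + μ * r⁻¹ ^ k) - Real.log (b k)) / 2| := abs_add_le _ _
      _ ≤ _ := by rw [e1, e2]; linarith [hδ1 k]
  -- bounded partial sums of |D|
  have hgeom : ∀ N, ∑ k ∈ range N, μ * r⁻¹ ^ k ≤ μ * (1 - r⁻¹)⁻¹ := by
    intro N
    rw [← mul_sum]
    have : ∑ k ∈ range N, r⁻¹ ^ k ≤ (1 - r⁻¹)⁻¹ := by
      rw [← tsum_geometric_of_lt_one hq0 hq1]
      exact (summable_geometric_of_lt_one hq0 hq1).sum_le_tsum (range N) fun i _ => pow_nonneg hq0 i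
    exact mul_le_mul_of_nonneg_left this hμ
  have hS : ∀ N, ∑ k ∈ range N, |D k| ≤ 2 * |D 0| + μ * (1 - r⁻¹)⁻¹ / min u₀ u₁ := by
    intro N
    have step : ∑ k ∈ range N, |D (k + 1)| ≤
        (∑ k ∈ range N, |D k|) / 2 + (μ * (1 - r⁻¹)⁻¹ / min u₀ u₁) / 2 := by
      calc ∑ k ∈ range N, |D (k + 1)|
          ≤ ∑ k ∈ range N, (|D k| / 2 + (μ * r⁻¹ ^ k / min u₀ u₁) / 2) :=
            sum_le_sum fun k _ => habs k
        _ = (∑ k ∈ range N, |D k|) / 2 + ((∑ k ∈ range N, μ * r⁻¹ ^ k) / min u₀ u₁) / 2 := by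
            rw [sum_add_distrib, sum_div, sum_div, sum_div]
        _ ≤ _ := by
            have := div_le_div_of_nonneg_right (hgeom N) hm0.le
            linarith
    have e : ∑ k ∈ range (N + 1), |D k| = (∑ k ∈ range N, |D (k + 1)|) + |D 0| :=
      sum_range_succ' (fun k => |D k|) N
    have mono : ∑ k ∈ range N, |D k| ≤ ∑ k ∈ range (N + 1), |D k| := by
      rw [sum_range_succ]; linarith [abs_nonneg (D N)]
    linarith
  have hsabs : Summable fun k => |D k| := summable_of_sum_range_le (fun k => abs_nonneg _) hS
  have hsD : Summable D := hsabs.of_abs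
  have hw_eq : ∀ k, Real.log (b k) = Real.log (b 0) + ∑ i ∈ range k, D i := fun k => by
    simp only [hD]
    rw [sum_range_sub (fun i => Real.log (b i)) k]
    ring
  have hwlim : Tendsto (fun k => Real.log (b k)) atTop (𝓝 (Real.log (b 0) + ∑' i, D i)) :=
    (hsD.hasSum.tendsto_sum_nat.const_add (Real.log (b 0))).congr fun k => (hw_eq k).symm
  refine ⟨Real.exp (Real.log (b 0) + ∑' i, D i), Real.exp_pos _, ?_⟩
  exact ((Real.continuous_exp.tendsto _).comp hwlim).congr fun k => Real.exp_log (hbpos k)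

/-! ## Gluing the two orbits into a two-sided steady state -/

/-- Glue a forward orbit `f` (shells `j ≥ 0`) and a backward orbit `b` (`b k` = shell `1 − k`). -/
def glue (f b : ℕ → ℝ) : ℤ → ℝ
  | Int.ofNat n => f n
  | Int.negSucc k => b (k + 2)

theorem glue_natCast (f b : ℕ → ℝ) (n : ℕ) : glue f b (n : ℤ) = f n := rfl

theorem glue_one_sub (f b : ℕ → ℝ) (hb0 : b 0 = f 1) (hb1 : b 1 = f 0) (k : ℕ) :
    glue f b (1 - (k : ℤ)) = b k := by
  rcases k with _ | _ | k
  · have e : (1 : ℤ) - ((0 : ℕ) : ℤ) = ((1 : ℕ) : ℤ) := by simp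
    rw [e, glue_natCast, hb0]
  · have e : (1 : ℤ) - ((1 : ℕ) : ℤ) = ((0 : ℕ) : ℤ) := by simp
    rw [e, glue_natCast, hb1]
  · have : (1 : ℤ) - ((k + 2 : ℕ) : ℤ) = Int.negSucc k := by
      rw [Int.negSucc_eq]; push_cast; ring
    rw [this]
    rfl

/-! ## The statement -/

/-- **Cascade soliton of the two-sided unforced viscous dyadic model** (CF normal form, ratio `r`,
reduced viscosity `μ`): a positive solution `u : ℤ → ℝ` of `u_{j−1}² − u_j u_{j+1} = μ r^j u_j` for
ALL `j ∈ ℤ` (no forcing shell), with finite positive total dissipation `Σ_{j∈ℤ} μ r^j u_j²` and the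
two-sided Kolmogorov bound `0 < m ≤ u_j ≤ M` on the large scales `j ≤ 1` and an exactly
self-similar far field `u_{−k} → L > 0` (`k → ∞`) — the route's K41 envelope + non-degenerate DSS
profile, which in normal form is the constant sequence. -/
structure IsCascadeSoliton (μ r : ℝ) (u : ℤ → ℝ) : Prop where
  pos : ∀ j, 0 < u j
  steady : ∀ j : ℤ, u (j - 1) ^ 2 - u j * u (j + 1) = μ * r ^ j * u j
  summable : Summable fun j : ℤ => μ * r ^ j * u j ^ 2
  dissipation_pos : 0 < ∑' j : ℤ, μ * r ^ j * u j ^ 2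
  farField : ∃ m M : ℝ, 0 < m ∧ ∀ j : ℤ, j ≤ 1 → m ≤ u j ∧ u j ≤ M
  selfSimilar : ∃ L : ℝ, 0 < L ∧ Tendsto (fun k : ℕ => u (-(k : ℤ))) atTop (𝓝 L)

/-- The S-analogue in the same model, for comparison ONLY (neither claimed nor proved here): the
steady zeroth law of the FORCED one-sided model at ratio `r` — a dissipation floor for every
Cheskidov–Friedlander steady state with small reduced viscosity.  In the tree this is
`IsSteadyState.half_lt_tsum_dissipation` (with `ε = 1/2`, `μ₀ = 1`) for `1 < r < 2` ONLY. -/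
def DyadicSteadyZerothLawAt (r : ℝ) : Prop :=
  ∃ ε μ₀ : ℝ, 0 < ε ∧ 0 < μ₀ ∧ ∀ μ : ℝ, 0 < μ → μ ≤ μ₀ → ∀ A : ℕ → ℝ,
    Literature.Analysis.FluidPDE.CheskidovFriedlander2009.IsSteadyState μ r A →
      ε ≤ ∑' j, μ * r ^ j * A j ^ 2

/-- The S-analogue at the Kolmogorov ratio `r = 2^{4/3}` (`c = 1`): NOT a theorem in scope. -/
def DyadicSteadyZerothLawK41 : Prop := DyadicSteadyZerothLawAt ((2 : ℝ) ^ (4 / 3 : ℝ))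

/-- For the record: inside the tree's range `1 < r < 2` the S-analogue IS a theorem
(`IsSteadyState.half_lt_tsum_dissipation`), so NO witness is claimed there. -/
theorem dyadicSteadyZerothLawAt_of_lt_two {r : ℝ} (hr1 : 1 < r) (hr2 : r < 2) :
    DyadicSteadyZerothLawAt r :=
  ⟨1 / 2, 1, by norm_num, one_pos, fun _μ hμ hμ1 _A hA =>
    (hA.half_lt_tsum_dissipation hμ hμ1 hr1 hr2).le⟩

/-! ## The rung -/

/-- **BC5 rung for `ConeDesingularisation`.**  For every reduced viscosity `μ > 0`, every ratio
`r > 1` and every normalisation `x₀ > 0` the two-sided unforced viscous dyadic model has a cascade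
soliton with `u 0 = x₀`. -/
theorem ConeDesingularisation_rung {μ r x₀ : ℝ} (hμ : 0 < μ) (hr : 1 < r) (hx : 0 < x₀) :
    ∃ u : ℤ → ℝ, u 0 = x₀ ∧ IsCascadeSoliton μ r u := by
  have hr0 : 0 < r := by linarith
  obtain ⟨t, ht⟩ := exists_immortal hμ hr0 hx
  have ht1 : 0 < t := by simpa using ht 1
  -- forward orbit `f`, backward orbit `b` from `u₀ = x₀`, `u₁ = t`
  set f : ℕ → ℝ := orb μ r x₀ t with hf
  set b : ℕ → ℝ := back μ r x₀ t with hb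
  have hb0 : b 0 = f 1 := by simp [hf, hb]
  have hb1 : b 1 = f 0 := by simp [hf, hb]
  have hbpos : ∀ k, 0 < b k := back_pos hμ.le hr0 hx ht1
  refine ⟨glue f b, by rw [show (0 : ℤ) = ((0 : ℕ) : ℤ) from rfl, glue_natCast, hf]; rfl, ?_⟩
  have hG1 : ∀ k : ℕ, glue f b (1 - (k : ℤ)) = b k := glue_one_sub f b hb0 hb1
  -- positivity
  have hpos : ∀ j, 0 < glue f b j := by
    rintro (n | k)
    · exact ht n
    · exact hbpos (k + 2)
  -- the steady equation on both halves
  have hsteady : ∀ j : ℤ, glue f b (j - 1) ^ 2 - glue f b j * glue f b (j + 1) =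
      μ * r ^ j * glue f b j := by
    intro j
    rcases le_or_gt 1 j with hj | hj
    · -- `j = n + 1`, forward relation
      obtain ⟨n, hn⟩ : ∃ n : ℕ, j = (n : ℤ) + 1 := ⟨(j - 1).toNat, by omega⟩
      subst hn
      have e1 : ((n : ℤ) + 1 - 1) = ((n : ℕ) : ℤ) := by ring
      have e2 : ((n : ℤ) + 1) = ((n + 1 : ℕ) : ℤ) := by push_cast; ring
      have e3 : ((n : ℤ) + 1 + 1) = ((n + 2 : ℕ) : ℤ) := by push_cast; ring
      rw [e1, e3, e2, glue_natCast, glue_natCast, glue_natCast, zpow_natCast]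
      exact orb_rel t n (ht (n + 1)).ne'
    · -- `j = -k`, backward relation
      obtain ⟨k, hk⟩ : ∃ k : ℕ, j = -(k : ℤ) := ⟨(-j).toNat, by omega⟩
      subst hk
      have e1 : (-(k : ℤ) - 1) = 1 - ((k + 2 : ℕ) : ℤ) := by push_cast; ring
      have e2 : (-(k : ℤ)) = 1 - ((k + 1 : ℕ) : ℤ) := by push_cast; ring
      have e3 : (-(k : ℤ) + 1) = 1 - ((k : ℕ) : ℤ) := by ring
      rw [e1, e3, e2, hG1, hG1, hG1]
      have hz : r ^ (1 - ((k + 1 : ℕ) : ℤ)) = r⁻¹ ^ k := by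
        rw [show (1 : ℤ) - ((k + 1 : ℕ) : ℤ) = -(k : ℤ) by push_cast; ring, zpow_neg, zpow_natCast,
          inv_pow]
      rw [hz, hb, back_add_two_sq hμ.le hr0 hx ht1 k]
      ring
  -- summability over `ℤ` from the two telescoping sums
  have hsumm : Summable fun j : ℤ => μ * r ^ j * glue f b j ^ 2 := by
    refine Summable.of_nat_of_neg_add_one ?_ ?_
    · simpa only [glue_natCast, zpow_natCast] using summable_dissipation_forward hμ hr0 ht
    · have hs := (summable_nat_add_iff 1).mpr (summable_dissipation_back hμ.le hr hx ht1)
      refine hs.congr fun n => ?_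
      have e : (-((n : ℤ) + 1)) = 1 - ((n + 2 : ℕ) : ℤ) := by push_cast; ring
      have hz : r ^ (-((n : ℤ) + 1)) = r⁻¹ ^ (n + 1) := by
        rw [show (-((n : ℤ) + 1)) = -((n + 1 : ℕ) : ℤ) by push_cast; ring, zpow_neg, zpow_natCast,
          inv_pow]
      simp only [hz]
      rw [e, hG1]
  refine ⟨hpos, hsteady, hsumm, hsumm.tsum_pos (fun j => ?_) 0 ?_, ?_, ?_⟩
  · have := hpos j; have := zpow_pos hr0 j; positivity
  · have := hpos 0; simp only [zpow_zero, mul_one]; positivity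
  · refine ⟨min x₀ t, max x₀ t + μ * (1 - r⁻¹)⁻¹, lt_min hx ht1, fun j hj => ?_⟩
    obtain ⟨k, hk⟩ : ∃ k : ℕ, j = 1 - (k : ℤ) := ⟨(1 - j).toNat, by omega⟩
    subst hk
    rw [hG1]
    exact ⟨min_le_back hμ.le hr0 hx ht1 k, back_le_const hμ.le hr hx ht1 k⟩
  · obtain ⟨L, hL, hlim⟩ := tendsto_back hμ.le hr hx ht1
    refine ⟨L, hL, (hlim.comp (tendsto_add_atTop_nat 1)).congr fun k => ?_⟩
    have e : (-(k : ℤ)) = 1 - ((k + 1 : ℕ) : ℤ) := by push_cast; ring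
    simp only [Function.comp_def]
    rw [e, hG1]

/-- **The rung at the Kolmogorov ratio** `r = 2^{4/3}` (`c = 1`, energy spectrum `k^{-5/3}`),
outside the range `1 < r < 2` in which the S-analogue `DyadicSteadyZerothLawAt r` is a tree
theorem. -/
theorem ConeDesingularisation_rung_K41 {μ : ℝ} (hμ : 0 < μ) :
    ∃ u : ℤ → ℝ, u 0 = 1 ∧ IsCascadeSoliton μ ((2 : ℝ) ^ (4 / 3 : ℝ)) u := by
  refine ConeDesingularisation_rung hμ ?_ one_pos
  have : (1 : ℝ) < 2 := by norm_num
  calc (1 : ℝ) = (2 : ℝ) ^ (0 : ℝ) := by simp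
    _ < (2 : ℝ) ^ (4 / 3 : ℝ) := Real.rpow_lt_rpow_of_exponent_lt this (by norm_num)

/-- The Kolmogorov ratio lies outside the tree's zeroth-law range: `2 ≤ 2^{4/3}`. -/
theorem two_le_ratio_K41 : (2 : ℝ) ≤ (2 : ℝ) ^ (4 / 3 : ℝ) := by
  calc (2 : ℝ) = (2 : ℝ) ^ (1 : ℝ) := by simp
    _ ≤ (2 : ℝ) ^ (4 / 3 : ℝ) := Real.rpow_le_rpow_of_exponent_le (by norm_num) (by norm_num)

end Summit.AnomalousDissipation.AnomalousDissipation.Cruxes.ConeDesingularisation.DyadicRung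

end
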